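import Summits.CriticalPhenomena.Ising3DConformalLimit.Theorems.LatticeSDPCertificatesCriticalStateFeasibleRP
import Summits.CriticalPhenomena.Ising3DConformalLimit.Theorems.HyperoctahedralRPInversionUpgradeNormalisedLatticeRP
import HarnessLib

/-!
# Bond-mirror reflection positivity of the critical `ℤ³` Ising correlators: stub
# `stub_bondMirrorRP` of line `birth` for crux `CanonicalBranchRefutation.IsingLimitHeritage`
# (stmt-CriticalPhenomena-15523)

Statement.  Fix a coordinate `τ : Fin 3` and let `θ♭_τ : ℤ³ → ℤ³`, `k ↦ (k with k_τ ↦ -1 - k_τ)`,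
be the reflection in the BOND plane `{k_τ = -1/2}` (the tree's `axisRefl τ (-1)`).  For finitely
many lattice configurations `z^a : Fin (k a) → ℤ³` in the closed half-lattice `{k_τ ≥ 0}` and real
coefficients `c_a`,
`0 ≤ Σ_{a,b} c_a c_b ⟨∏ᵢ σ_{θ♭_τ z^a_i} ∏ⱼ σ_{z^b_j}⟩_{β_c}`,
the correlators being the critical infinite-volume ones `criticalCorr 3` (spin monomials,
multiplicities allowed, the two monomials concatenated by `Fin.append`).

Proof (Fröhlich–Israel–Lieb–Simon 1978 §2, reflection positivity "through bonds" of the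
nearest-neighbour ferromagnet; Friedli–Velenik 2017 Lemma 10.8).
* `θ♭_τ` is an involutive automorphism of the nearest-neighbour graph `zdGraph d` moving the
  centred boxes by one unit, so the symmetrised boxes `Λ(L) ∪ θ♭_τ Λ(L)` (`symBox`) are
  `θ♭_τ`-stable finite volumes; the half `P = {k_τ ≥ 0}` is in the FILS bond position:
  `ℤ^d = P ⊔ θ♭_τ P` and every edge leaving `P` joins `x` (with `x_τ = 0`) to `θ♭_τ x`
  (with `(θ♭_τ x)_τ = -1`).
* `F := Σ_a c_a ∏ᵢ σ_{z^a_i}` is bounded, measurable and depends only on the spins in `P`, and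
  `(F ∘ θ♭_τ^*) · F = Σ_{a,b} c_a c_b ∏ σ_{θ♭_τ z^a ++ z^b}`; hence, by the tree theorem
  `isingExpect_free_reflect_mul_self_nonneg_of_cross` (free finite volumes of the n.n. ferromagnet,
  `β ≥ 0`, are reflection positive through bonds) and linearity of the finite-volume expectation,
  `0 ≤ Σ_{a,b} c_a c_b ⟨∏ σ_{θ♭_τ z^a ++ z^b}⟩^∅_{Λ(L) ∪ θ♭_τ Λ(L); β, h}` for every `L`, `β ≥ 0`, `h`.
* At `β = β_c(d)`, `h = 0`, `d ≥ 3`, every spin monomial is a spin product (`σ² = 1`), and the free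
  correlations along the symmetrised boxes converge to the plus correlations because
  `m*(β_c) = 0` (Aizenman–Duminil-Copin–Sidoravicius 2015;
  `LatticeSDPCertificatesFeasible.tendsto_isingCorr_free_symBox`), i.e. to `criticalCorr d`; the
  inequality passes to the limit `L → ∞` (`ge_of_tendsto'`).

References: J. Fröhlich, R. Israel, E. H. Lieb, B. Simon, Comm. Math. Phys. 62 (1978) 1–34, §2;
S. Friedli, Y. Velenik, *Statistical Mechanics of Lattice Systems* (CUP 2017), Lemma 10.8,
Thm. 3.28; M. Aizenman, H. Duminil-Copin, V. Sidoravicius, Comm. Math. Phys. 334 (2015),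
Thm. 1.2. No definitions are introduced.
-/

noncomputable section

open Filter Topology MeasureTheory
open Literature.Probability.LatticeModels
open Summit.CriticalPhenomena.Ising3DConformalLimit.Cruxes.InversionUpgradeNormalised.FreeEndpointGaussianClosure

namespace Summit.CriticalPhenomena.Ising3DConformalLimit.Cruxes.IsingLimitHeritage.Birth

variable {d : ℕ}

/-! ### The bond mirror `θ♭_τ = axisRefl τ (-1) : x ↦ (x with x_τ ↦ -1 - x_τ)` of `ℤ^d` -/

/-- Coordinates of the bond mirror: `axisRefl τ (-1) x = Function.update x τ (-1 - x τ)`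
(reflection of `ℤ^d` in the hyperplane `{x_τ = -1/2}`, FILS 1978 §2). -/
theorem axisRefl_neg_one_eq_update (τ : Fin d) (x : Site d) :
    axisRefl τ (-1) x = Function.update x τ (-1 - x τ) := by
  funext j
  rw [axisRefl_apply]
  by_cases hj : j = τ
  · subst hj
    rw [if_pos rfl, Function.update_self]
  · rw [if_neg hj, Function.update_of_ne hj]

/-- The bond mirror exchanges the half-lattice `{x_τ ≥ 0}` and its complement `{x_τ ≤ -1}`:
`x_τ ≥ 0 ↔ ¬ (-1 - x_τ ≥ 0)`. -/
theorem nonneg_apply_iff_not_nonneg_axisRefl_neg_one (τ : Fin d) (x : Site d) :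
    0 ≤ x τ ↔ ¬0 ≤ axisRefl τ (-1) x τ := by
  rw [axisRefl_apply, if_pos rfl]
  omega

/-- Every edge of `ℤ^d` leaving the half-lattice `{x_τ ≥ 0}` is a bond `{x, θ♭_τ x}` crossing the
plane `{x_τ = -1/2}` (an edge changes one coordinate by `±1`). -/
theorem eq_axisRefl_neg_one_of_adj (τ : Fin d) {x y : Site d} (hxy : (zdGraph d).Adj x y)
    (hx : 0 ≤ x τ) (hy : ¬0 ≤ y τ) : y = axisRefl τ (-1) x := by
  obtain ⟨l, hl, hrest⟩ := zdGraph_adj_coord hxy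
  funext j
  rw [axisRefl_apply]
  by_cases hj : j = τ
  · subst hj
    rw [if_pos rfl]
    by_cases hlj : l = j
    · subst hlj
      omega
    · have := hrest j (Ne.symm hlj) ▸ hx
      omega
  · rw [if_neg hj]
    by_cases hlj : l = j
    · subst hlj
      have := hrest τ (fun h => hj h.symm)
      omega
    · exact hrest j (Ne.symm hlj) ▸ rfl

/-- The bond mirror moves the centred boxes by one unit: `θ♭_τ Λ(L) ⊆ Λ(L + 1)`. -/
theorem axisRefl_neg_one_mem_box (τ : Fin d) (L : ℕ) (y : Site d) (hy : y ∈ box d L) :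
    axisRefl τ (-1) y ∈ box d (L + 1) := by
  simpa using axisRefl_mem_box τ (-1) L y hy

/-! ### Reflection positivity of the free finite volumes through the bond planes -/

/-- **Finite-volume bond-mirror reflection positivity for combinations of spin monomials.**
For a `θ♭_τ`-stable finite volume `Λ ⊆ ℤ^d`, `β ≥ 0`, real `h`, configurations `z^a` in the
half-lattice `{k_τ ≥ 0}` and real coefficients `c_a`,
`0 ≤ Σ_{a,b} c_a c_b ⟨∏ σ_{θ♭_τ z^a ++ z^b}⟩^∅_{Λ;β,h}`: the tree theorem
`isingExpect_free_reflect_mul_self_nonneg_of_cross` (FILS 1978 §2, RP through bonds of the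
n.n. ferromagnet; Friedli–Velenik 2017 Lemma 10.8) applied to `F = Σ_a c_a ∏ᵢ σ_{z^a_i}` and the
half `P = {k_τ ≥ 0}`, followed by the expansion
`(F ∘ θ♭_τ^*) F = Σ_{a,b} c_a c_b ∏ σ_{θ♭_τ z^a ++ z^b}` and linearity. -/
theorem sum_sum_mul_isingExpect_free_bondMirror_nonneg (τ : Fin d) {Λ : Finset (Site d)}
    (hΛ : ∀ x, x ∈ Λ ↔ axisRefl τ (-1) x ∈ Λ) {β : ℝ} (hβ : 0 ≤ β) (h : ℝ) {m : ℕ}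
    (k : Fin m → ℕ) (z : (a : Fin m) → Fin (k a) → Site d) (c : Fin m → ℝ)
    (hz : ∀ a i, 0 ≤ z a i τ) :
    0 ≤ ∑ a, ∑ b, c a * c b * isingExpect (zdGraph d) Λ β h .free
      (spinMonomial (Fin.append (fun i => Function.update (z a i) τ (-1 - z a i τ)) (z b))) := by
  classical
  -- the half-lattice `P = {k_τ ≥ 0}` is in the FILS bond position for `θ♭_τ`
  let P : Set (Site d) := {x | 0 ≤ x τ}
  have hmemP : ∀ x, x ∈ P ↔ 0 ≤ x τ := fun x => Iff.rfl
  have hP : ∀ x, x ∈ P ↔ axisRefl τ (-1) x ∉ P := fun x => by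
    rw [hmemP, hmemP]
    exact nonneg_apply_iff_not_nonneg_axisRefl_neg_one τ x
  have hcross : ∀ x y, (zdGraph d).Adj x y → x ∈ P → y ∉ P → y = axisRefl τ (-1) x :=
    fun x y hxy hx hy => eq_axisRefl_neg_one_of_adj τ hxy ((hmemP x).1 hx)
      (fun h' => hy ((hmemP y).2 h'))
  -- the observable `F = Σ_a c_a ∏ᵢ σ_{z^a_i}`
  have hFm : Measurable fun σ : SpinConfig (Site d) => ∑ a, c a * spinMonomial (z a) σ :=
    Finset.measurable_sum _ fun a _ => (measurable_spinMonomial (z a)).const_mul (c a)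
  have hFP : DependsOn (fun σ : SpinConfig (Site d) => ∑ a, c a * spinMonomial (z a) σ) P := by
    intro σ σ' hσ
    refine Finset.sum_congr rfl fun a _ => ?_
    simp only [spinMonomial, spinAt]
    congr 1
    exact Finset.prod_congr rfl fun i _ => by rw [hσ (z a i) ((hmemP _).2 (hz a i))]
  have hFb : ∃ C, ∀ σ : SpinConfig (Site d), |∑ a, c a * spinMonomial (z a) σ| ≤ C := by
    refine ⟨∑ a, |c a|, fun σ => (Finset.abs_sum_le_sum_abs _ _).trans (Finset.sum_le_sum
      fun a _ => ?_)⟩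
    -- `|∏ᵢ σ_{z^a_i}| ≤ 1`: the monomial is the spin product of its odd-multiplicity sites
    obtain ⟨A, hA⟩ := exists_spinMonomial_eq_spinProduct (z a)
    rw [abs_mul, hA]
    exact mul_le_of_le_one_right (abs_nonneg _) (abs_spinProduct_le_one A σ)
  -- reflection positivity of the free volume `Λ` through the bond plane
  have hpos := isingExpect_free_reflect_mul_self_nonneg_of_cross (zdGraph d) (axisRefl τ (-1))
    (axisRefl_involutive τ (-1)) (fun x y hxy => (zdGraph_adj_axisRefl τ (-1) x y).2 hxy) hΛ hP
    hcross hβ h hFm hFP hFb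
  -- expansion of `(F ∘ θ^*) F` and linearity
  have hexp : (fun σ : SpinConfig (Site d) =>
      (∑ a, c a * spinMonomial (z a) (configReflect (axisRefl τ (-1)) σ)) *
        ∑ a, c a * spinMonomial (z a) σ) = fun σ => ∑ a, ∑ b, c a * c b *
        spinMonomial (Fin.append (fun i => Function.update (z a i) τ (-1 - z a i τ)) (z b)) σ := by
    funext σ
    rw [Fintype.sum_mul_sum]
    refine Finset.sum_congr rfl fun a _ => Finset.sum_congr rfl fun b _ => ?_
    have hrefl : spinMonomial (z a) (configReflect (axisRefl τ (-1)) σ) =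
        spinMonomial (fun i => axisRefl τ (-1) (z a i)) σ := rfl
    have hupd : (fun i => axisRefl τ (-1) (z a i)) =
        fun i => Function.update (z a i) τ (-1 - z a i τ) :=
      funext fun i => axisRefl_neg_one_eq_update τ (z a i)
    rw [spinMonomial_append_apply, hrefl, hupd]
    ring
  rw [hexp, isingExpect_sum_sum_mul_spinMonomial Λ β h .free (fun a b => c a * c b)] at hpos
  exact hpos

/-! ### The box limit of the free monomial expectations along the symmetrised boxes -/

/-- **Free monomial expectations along symmetrised boxes converge to the critical correlator.**
For `d ≥ 3`, an `Equiv` `θ` of `ℤ^d` moving boxes by at most `R` and `w : Fin n → ℤ^d`,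
`⟨∏ σ_{wᵢ}⟩^∅_{Λ(L) ∪ θΛ(L); β_c, 0} → criticalCorr d n w`: the monomial is a spin product
(`σ² = 1`, `exists_spinMonomial_eq_spinProduct`), the free correlations along the symmetrised
boxes converge to the plus correlations when `m*(β) = 0`
(`LatticeSDPCertificatesFeasible.tendsto_isingCorr_free_symBox`), and `m*(β_c) = 0` for
`d ≥ 3` (Aizenman–Duminil-Copin–Sidoravicius 2015). -/
theorem tendsto_isingExpect_spinMonomial_free_symBox (hd : 3 ≤ d) {θ : Site d ≃ Site d}
    {R : ℕ} (hR : ∀ L, ∀ y ∈ box d L, θ y ∈ box d (L + R)) {n : ℕ} (w : Fin n → Site d) :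
    Tendsto (fun L => isingExpect (zdGraph d) (symBox θ L) (criticalBeta d) 0 .free
      (spinMonomial w)) atTop (𝓝 (criticalCorr d n w)) := by
  obtain ⟨A, hA⟩ := exists_spinMonomial_eq_spinProduct w
  have hlim : criticalCorr d n w = plusCorr d (criticalBeta d) 0 A := by
    show plusExpect d (criticalBeta d) 0 (spinMonomial w) = _
    rw [hA]
    rfl
  rw [hlim, hA]
  exact LatticeSDPCertificatesFeasible.tendsto_isingCorr_free_symBox hR (criticalBeta_nonneg d)
    (spontaneousMagnetization_criticalBeta_eq_zero_holds (d := d) hd) A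

/-! ### The registered stub -/

/-- **stub_bondMirrorRP** (bond-plane reflection positivity of the critical `ℤ³` correlators,
Gram form on spin monomials). For every axis `τ : Fin 3`, finitely many lattice configurations
`z^a` in the closed half-lattice `{k_τ ≥ 0}` and real coefficients `c_a`,
`0 ≤ Σ_{a,b} c_a c_b ⟨∏ σ_{θ♭_τ z^a ++ z^b}⟩_{β_c(3)}` with `θ♭_τ k = (k with k_τ ↦ -1 - k_τ)`
the mirror in the bond plane `{k_τ = -1/2}`: finite-volume free reflection positivity through
bonds (`sum_sum_mul_isingExpect_free_bondMirror_nonneg`, FILS 1978 §2 / Friedli–Velenik 2017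
Lemma 10.8) on the `θ♭_τ`-symmetrised boxes `Λ(L) ∪ θ♭_τ Λ(L)` at `β = β_c ≥ 0`, `h = 0`, and the
box limit of every free monomial expectation (`tendsto_isingExpect_spinMonomial_free_symBox`,
`m*(β_c) = 0`, ADS 2015), `ge_of_tendsto'`. -/
theorem stub_bondMirrorRP :
    ∀ (τ : Fin 3) (m : ℕ) (k : Fin m → ℕ) (z : (a : Fin m) → Fin (k a) → Site 3) (c : Fin m → ℝ),
      (∀ a i, 0 ≤ z a i τ) →
      0 ≤ ∑ a, ∑ b, c a * c b *
        criticalCorr 3 (k a + k b)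
          (Fin.append (fun i => Function.update (z a i) τ (-1 - z a i τ)) (z b)) := by
  intro τ m k z c hz
  have hT : Tendsto (fun L : ℕ => ∑ a, ∑ b, c a * c b *
      isingExpect (zdGraph 3) (symBox (axisRefl τ (-1)) L) (criticalBeta 3) 0 .free
        (spinMonomial (Fin.append (fun i => Function.update (z a i) τ (-1 - z a i τ)) (z b))))
      atTop (𝓝 (∑ a, ∑ b, c a * c b * criticalCorr 3 (k a + k b)
        (Fin.append (fun i => Function.update (z a i) τ (-1 - z a i τ)) (z b)))) :=
    tendsto_finsetSum _ fun a _ => tendsto_finsetSum _ fun b _ =>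
      (tendsto_isingExpect_spinMonomial_free_symBox (d := 3) (by norm_num)
        (axisRefl_neg_one_mem_box τ) _).const_mul _
  exact ge_of_tendsto' hT fun L => sum_sum_mul_isingExpect_free_bondMirror_nonneg τ
    (fun x => mem_symBox_iff (axisRefl_involutive τ (-1)) x) (criticalBeta_nonneg 3) 0 k z c hz

end Summit.CriticalPhenomena.Ising3DConformalLimit.Cruxes.IsingLimitHeritage.Birth

end
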